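import Literature.NumberTheory.EllipticCurves.Kobayashi2003.SignedColemanKatoZeta
import Literature.NumberTheory.EllipticCurves.KuriharaNumberInvariants
import Literature.NumberTheory.EllipticCurves.Isogeny
import Literature.NumberTheory.EllipticCurves.Tamagawa
import HarnessLib

/-!
# Castella–Sano (arXiv:2601.14504, PREPRINT 2026), Thm. 1 (ii) ⟹ (i) AT THE TRIVIAL CHARACTER: KATO'S MAIN
# CONJECTURE for `T_pE` over `ℚ_∞` — read on the pinned objects of Kobayashi's `η = 1` Coleman/Kato package
# of ONE sign — gives Kim's Tamagawa-defect identity `∂^{(∞)}(δ̃) = ord_p Tam_E`, as an explicitly labelled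
# OPEN hypothesis (nothing asserted; NEVER a theorem)

Topic `NumberTheory/EllipticCurves`, sub-directory `CastellaSano2026` (namespace = path). HONEST FRAMING: an
UNREFEREED preprint enters the tree only as an explicitly labelled OPEN hypothesis (`[claim: …, status:
under-review]`), NEVER as a theorem; nothing here is asserted about any curve; nothing is booked; BSD is not
proved by any of this. This is the CONVERSE companion of the accepted
`CastellaSano2026.thm1_katoMainIdentity_of_kimTamagawaDefect_OPEN` (same directory, file
`KatoMainIdentityOfKimTamagawaDefectOPEN.lean`: Thm. 1 (i) ⟹ (ii), same frame, hypothesis and conclusion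
exchanged), written so that the kernel can discharge the Kobayashi-Thm-7.4 half of the accepted COMPOSITE binder
`Kobayashi74_CastellaSano2026_kimTamagawaDefect_of_signedMC_OPEN`
(`Summits/BirchSwinnertonDyer/Rank1Residual/Supersingular/KobayashiMainConjectureKuriharaRigidity.lean` §4,
p609053: «Kobayashi Thm. 7.4 (one signed main conjecture ⟹ Kato's) ∘ Castella–Sano Thm. 1 (ii) ⟹ (i)»): the
binder below is the Castella–Sano half ALONE. Written for the cell `bsd-ssimc` (HOME
`run/shared/lean/pub/bsd-ssimc/`), seat `bsd-line-slh-p1-w2` (g2), route `SignedLowerHalves`, crux item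
stmt-BirchSwinnertonDyer-19001 `KobayashiLowerHalfLargeImage`, line `kurihara_rigidity` (the lead's
EQUIVALENCE «crux 3 on X7 ∧ ¬CM ∧ Surj ∧ p ≥ 5 ⟺ Kim's Conjecture 1.10 there», p609449, consumes the composite
binder). Consumer (kernel, Summits-side):
`Theorems/SignedLowerHalvesKobayashiLowerHalfLargeImageKuriharaRigidityThm74Converse.lean`
(`KuriharaRigidity.katoMainIdentity_of_kobayashiMainConjecture`,
`KuriharaRigidity.kobayashi74_castellaSano2026_kimTamagawaDefect_of_signedMC_OPEN_of_katoFrame`).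

## Source, verbatim (F. Castella, T. Sano, *On refined nonvanishing conjectures by Kurihara and
## Kolyvagin*, arXiv:2601.14504 v1 (2026); held text `paper:arxiv-2601.14504`, page = file number;
## FRESHNESS 2026-08-28: arXiv only, no journal record)

§1.1.1 (p0003): "Let `E/ℚ` be an elliptic curve of conductor `N` without complex multiplication, and fix an
odd prime `p` such that (sur) `ρ̄ : G_ℚ → Aut_{𝔽_p}(E[p])` is surjective. … Let `f ∈ S₂(Γ₀(N))` be the newform
attached to `E`. Let `Ω_E^+ = ∫_{E(ℝ)} ω_E` be the positive Néron period of `E` … Fix a modular parametrization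
`φ : X₀(N) → E` and let `c_φ ∈ ℤ` be the associated Manin constant … Assume that `p ∤ c_φ`." §1.1.3 (p0003–p0004):
"`𝓜(n) := max{𝓜 ≥ 0 : δ_n ∈ p^𝓜 ℤ/I_n}` (`∞` if `δ_n = 0`) … `𝓜_r := min{𝓜(n) : n ∈ 𝒩, ν(n) = r}` …
`𝓜_∞(δ) := lim_{r→∞, (−1)^r = ε} 𝓜_r`". §1.1.4 (p0004): "**Theorem 1.** Let `p > 3` be a prime such that
(sur) and (manin) both hold. Then the following are equivalent: (i) `𝓜_∞(δ) = ord_p(Tam_E)`, and hence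
Conjecture 2 holds. (ii) The Iwasawa Main Conjecture (conj:IMC-det) for `ℚ_∞/ℚ` holds." and "The Iwasawa Main
Conjecture (conj:IMC-det) for `ℚ_∞/ℚ` in the above results is a reformulation of [kato-euler-systems] in terms
of determinants of arithmetic complexes." §2.2 (p0009), Prop. 2.2.3: "Conjecture (conj:IMC-det) holds if and
only if `char_Λ(H¹(ℤ_S, 𝕋)/Λ·z_∞^{(S)}) = char_Λ(H²(ℤ_S, 𝕋))` as ideals in `Λ`". PROOF OF (ii) ⟹ (i): §2.4
(p0010 L44–L64): "Suppose the Iwasawa Main Conjecture (conj:IMC-det) holds. Then from Theorem (thm:str-Kato)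
and Corollary (cor:index-m-Q) we have … `𝓜_∞(κ_Λ^{Kato}(α)) = ord_p(#E(ℚ_p)[p^∞]) + ord_p(Tam_E)` … Since
the chain of equalities `𝓜_∞(κ_Λ^{Kato}(α)) = 𝓜_∞^{(m)}(κ_Λ^{Kato}(α)) = 𝓜_∞^{(m)}(κ^{Kato}) =
𝓜_∞(κ^{Kato}) = 𝓜_∞(δ) + ord_p(#E(ℚ_p)[p^∞])` follows from Proposition (prop:mccullen), Lemma (lem:congr-Kato),
Proposition (prop:mccullen), and Theorem (thm:der-ERL), respectively, combining (eq:M-kato) and (eq:chain)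
this gives the implication (ii) ⟹ (i) in Theorem (thmintro-Kur)." ANY reduction type of `E` at `p` (§1,
p0003: "allowing `E` to have any reduction type at `p`").

## Transcription (weaker than print; flags for the referee)

Frame = that of the companion (i) ⟹ (ii) file and of the package fact
`Kobayashi2003.thm62_63_73_signedColemanKato_zeta`: `W/ℚ` globally minimal (structure facts of `T_pW` as
instance BINDERS), `p` GOOD with `a_p = 0` (the preprint allows any reduction; the reading on the `η = 1`
SIGNED package needs good supersingular — weaker than print), a newform `f` of `W` (any level), the period
ratio `ϖ` (`ϖ·Ω(W) = Ω⁺_f`), the cyclotomic `κ` with generator `γ` matching the cyclotomic variable, and a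
sign `ε`. Castella–Sano's standing hypotheses: `5 ≤ p` («`p > 3`»); `¬ W.HasCM`; (sur) as
`W.HasSurjectiveModNGaloisRep p`; (manin) as the period-transfer clause `Ω(W) = u·Ω⁺_f`, `u ∈ ℚ`, `|u|_p = 1`
(reading `KR-period`, as in the companion and in every Kim-type fact of the tree). HYPOTHESIS (ii), Kato's
main conjecture over `ℚ_∞`, READ ON THE SIGN-`ε` PACKAGE exactly as the companion's conclusion reads it for
each sign: for all pinned `I : Kato2004.IwasawaH1Data W p κ γ` (`𝐇¹(T)^Δ`), `Y : W.FineSelmerDualData κ γ`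
(`X⁰(E/K_∞)^Δ ≅ 𝐇²(T)^Δ`, Kobayashi Prop. 7.1 ii)) there is a package datum
`d : Kobayashi2003.SignedColemanKatoData W p f ϖ κ γ ε I` with `Module.charIdeal Λ Y.X = Module.charIdeal Λ
(I.H ⧸ d.Z)`. READING FLAG `CS26-1-eta1-sign-reading` (new, the hypothesis side of the companion's
`CS26-1-eta1-zeta-line` / `CS26-1-package`): Kato's identity is sign-free; its reading through the data of ONE
sign `ε` is EQUIVALENT to it — along the package's four-term sequence (7.21) with Thm. 6.3 on ideals one has
`char(I.H ⧸ d.Z)·char X^ε = (ϖ·L_p^ε)·char X₀` for EVERY sign-`ε` datum `d` (kernel: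
`KuriharaRigidity.charIdeal_mul_eq_of_fourTermExact` with `fourTerm_data_of_signedColemanKato_of_isTorsion`), so
«identity at some sign-`ε` datum» ⟺ «`char X^ε = (ϖ·L_p^ε)`» ⟺ (Kobayashi Thm. 7.4, PUBLISHED, p. 13) Kato's
main conjecture; hence the hypothesis below IMPLIES the printed (ii) and the typed implication is implied by,
never stronger than, the print. CONCLUSION (i) in the tree's vocabulary: `kuriharaPartialInfty W p f =
ord_p(W.tamagawaProduct)` — Kim's `∂^{(∞)}(δ̃)` over the CYCLIC Kolyvagin levels of the `Ω⁺_f`-normalised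
collection (`KuriharaNumberInvariants`). READING FLAG `CS26-1-cyclic-levels`, here in the direction where it
is LOAD-BEARING (as in the accepted converse binders `Kobayashi74_CastellaSano2026_kimTamagawaDefect_of_signedMC_OPEN`,
flag `Kim2026-(6)-cyclic-reading`, and `BSTW921c_CastellaSano2026_kimTamagawaDefect_OPEN` of
`Rank1Residual/Additive/N10TwistClauseCastellaSano.lean`): the printed `𝓜_∞(δ)` runs over all square-free
products of primes of `𝓛`; the Kolyvagin-system formalism "in the sense of [mazrub]" that the proof uses
(§2.1.1; Prop. 2.1.5, Lemma 2.1.1, Thm. 2.1.3) requires `T/(Frob_ℓ − 1)T` free of rank one, i.e. exactly the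
tree's cyclic primes (`IsCyclicKolyvaginLevel`, Kim Thm. 2.1 "`T/(Fr_ℓ − 1)T` is a cyclic `ℤ_p`-module"),
and the minimum is attained there by the rigidity Prop. 2.1.5 — so `𝓜_∞(δ) = ord_p Tam_E` is read as the
tree's cyclic-level equality; `|u|_p = 1` makes divisibility of `δ̃_n` by `p^j` insensitive to the
normalisation `Ω⁺_f` vs `Ω_E`. NEVER cite this `Prop` as a theorem; take it as an explicit hypothesis
`(hCSc : …)`.

What this binder is NOT: not Conjecture 2 / Kim's Conjecture 1.10 (no claim that the identity holds); not the
direction (i) ⟹ (ii) (the companion); not Thm. 2 (good ordinary / square-free supersingular cases); not a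
statement at `p = 3`; not Kobayashi's Thm. 7.4 (derived Summits-side by the kernel, both directions); not the
implicit `≥` half of §2 (the Summits-side reading binder `CastellaSano2026_sec2_tamagawaDefectGe_implicit_OPEN`).
(Docstring convention of the sibling files: the source's C-word is written `[C]` in the declaration docstring; this
module docstring carries the unaltered quotations.)

## References

* F. Castella, T. Sano, arXiv:2601.14504 (2026): §1.1.1–1.1.4 with Conj. 2, Thm. 1, Cor. 1 (PDF pp. 3–4),
  §2.1 Lemma 2.1.1, Thm. 2.1.3–2.1.4, Prop. 2.1.5 (PDF pp. 7–9), §2.2 Conj. 2.2.2, Prop. 2.2.3 (PDF p. 9),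
  §2.3 Prop. 2.3.1, Cor. 2.3.2, §2.4 (PDF pp. 10–11). [CastellaSano2026]
* C.-H. Kim, Amer. J. Math. 148 (2026) = arXiv:2203.12159: Conj. 1.10 (PDF p. 8), §1.5.1, Thm. 2.1.
  [Kim2022StructureSelmer]
* S. Kobayashi, Invent. Math. 152 (2003): §5 (p. 10), Thm. 6.3 (p. 11), Prop. 7.1 ii) (p. 12), Thm. 7.3 i),
  Thm. 7.4 and its proof (p. 13). [Kobayashi2003]
* K. Kato, Astérisque 295 (2004): §12.2, Thm. 12.5–12.6, Conj. 12.10. [Kato2004Asterisque]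
* B. Mazur, K. Rubin, Mem. AMS 799 (2004), §3.5 / §5.2 (admissible primes, `∂^{(r)}`). [MazurRubin2004]
-/

noncomputable section

open scoped Classical MatrixGroups ModularForm

open CongruenceSubgroup WeierstrassCurve Field Literature.NumberTheory.EllipticCurves
  Literature.NumberTheory.EllipticCurves.ModularForms Literature.NumberTheory.GaloisRepresentations

namespace Literature.NumberTheory.EllipticCurves.CastellaSano2026

/-- **OPEN HYPOTHESIS — UNREFEREED PREPRINT (Castella–Sano, arXiv:2601.14504, 2026), Thm. 1 (ii) ⟹ (i) at
the trivial character, Kato's main identity [C] read on Kobayashi's `η = 1` Coleman/Kato package of one sign.**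
Source: "Theorem 1. Let `p > 3` be a prime such that (sur) and (manin) both hold. Then the following are
equivalent: (i) `𝓜_∞(δ) = ord_p(Tam_E)` … (ii) The Iwasawa Main [C] for `ℚ_∞/ℚ` holds" (PDF p. 4; `E/ℚ`
non-CM, §1.1.1; (ii) = Kato's main identity `char_Λ(H¹(ℤ_S,𝕋)/Λz_∞^{(S)}) = char_Λ(H²(ℤ_S,𝕋))`, Prop.
2.2.3; proof of (ii) ⟹ (i) in §2.4, PDF p. 10; any reduction type at `p`). TRANSCRIBED on the frame of the
companion `thm1_katoMainIdentity_of_kimTamagawaDefect_OPEN` with hypothesis and conclusion exchanged: `W/ℚ`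
globally minimal, `5 ≤ p` GOOD with `a_p = 0` (weaker than print), a newform `f` of `W`, period ratio `ϖ`
(`ϖ·Ω(W) = Ω⁺_f`), cyclotomic `(κ, γ)` matching the variable, a sign `ε`; `¬ W.HasCM`; (sur)
`W.HasSurjectiveModNGaloisRep p`; (manin) as the period transfer `Ω(W) = u·Ω⁺_f`, `|u|_p = 1` (reading
`KR-period`); (ii) read on the sign-`ε` package — for all pinned `I : Kato2004.IwasawaH1Data W p κ γ`,
`Y : W.FineSelmerDualData κ γ` some package datum `d` (Kobayashi Thm. 6.2/6.3/7.3 i) + Kato 12.6 at `η = 1`)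
has `Module.charIdeal Λ Y.X = Module.charIdeal Λ (I.H ⧸ d.Z)` (reading `CS26-1-eta1-sign-reading`: by (7.21)
+ Thm. 6.3 + Kobayashi Thm. 7.4 this per-sign reading implies the printed (ii), module docstring) ⟹ (i) as
Kim's Tamagawa-defect identity over the cyclic levels of the `Ω⁺_f`-normalised collection,
`kuriharaPartialInfty W p f = ord_p(W.tamagawaProduct)` (reading `CS26-1-cyclic-levels`, load-bearing in this
direction, as in the accepted `Kobayashi74_CastellaSano2026_kimTamagawaDefect_of_signedMC_OPEN` /
`BSTW921c_CastellaSano2026_kimTamagawaDefect_OPEN`). NEVER cite this `Prop` as a theorem (FRESHNESS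
2026-08-28: arXiv v1 only); take it as an explicit hypothesis. Nothing asserted.
[claim: CastellaSano2026, status: under-review]
[cite: Kobayashi2003, §5 (p. 10), Thm. 6.3 (p. 11), Prop. 7.1 ii) (p. 12), Thm. 7.4 and its proof (p. 13)]
[cite: Kim2022StructureSelmer, §1.5.3 (PDF p. 8), §1.5.1 (PDF p. 7), Thm. 2.1 (§2.2)] -/
def thm1_kimTamagawaDefect_of_katoMainIdentity_OPEN : Prop :=
  ∀ (W : WeierstrassCurve ℚ) [W.IsElliptic] [W.IsGloballyMinimal] (p : ℕ) [Fact p.Prime]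
    [ContinuousSMul ℤ_[p] (W.tateModule p)] [Module.Free ℤ_[p] (W.tateModule p)]
    [Module.Finite ℤ_[p] (W.tateModule p)]
    {N : ℕ} [NeZero N] (f : CuspForm (Gamma0 N) 2) (ϖ : ℚ)
    (κ : ZpExtension ℚ p) (γ : absoluteGaloisGroup ℚ) (ε : ℤˣ),
  -- the frame of Kobayashi's `η = 1` package of sign `ε`, at `p ≥ 5`
    5 ≤ p → W.HasGoodReductionAtPrime p → W.frobeniusTrace p = 0 → IsNewformOf W f →
    (ϖ : ℝ) * W.realPeriodRat = plusPeriod f →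
    κ.IsCyclotomic → κ.IsTopGenerator γ → IsCyclotomicVariable p γ →
  -- Castella–Sano's standing hypotheses: non-CM, (sur), (manin) as the period transfer
    ¬ W.HasCM → W.HasSurjectiveModNGaloisRep p →
    (∃ u : ℚ, ‖(u : ℚ_[p])‖ = 1 ∧ W.realPeriodRat = u * plusPeriod f) →
  -- (ii): Kato's main identity, read on the pinned objects through the sign-`ε` `η = 1` package
    (∀ (I : Kato2004.IwasawaH1Data W p κ γ) (Y : W.FineSelmerDualData κ γ),
      ∃ d : Kobayashi2003.SignedColemanKatoData W p f ϖ κ γ ε I,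
        Module.charIdeal (IwasawaAlgebra p) Y.X =
          Module.charIdeal (IwasawaAlgebra p) (I.H ⧸ d.Z)) →
  -- (i): Kim's Tamagawa-defect identity `∂^{(∞)}(δ̃) = ord_p Tam_E` (cyclic levels)
    kuriharaPartialInfty W p f = (padicValNat p W.tamagawaProduct : ℕ∞)

end Literature.NumberTheory.EllipticCurves.CastellaSano2026

end
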